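import Literature.AlgebraicGeometry.Resolution.ArithmeticalThreefoldsClosedPoints
import Literature.AlgebraicGeometry.Resolution.RankOneReductionTrdeg
import HarnessLib

/-!
# Local uniformization in dimension three from (LU) at RANK-ONE closed centres

Topic: `Literature/AlgebraicGeometry/Resolution` (proofs only; no new notions, no new named
facts). `ArithmeticalThreefoldsClosedPoints.lean` reduces `LocalUniformization3 k` (relative local
uniformization of all affine models of dimension `≤ 3` over all fields, along ALL valuations)
to surface resolution (`CossartJannsenSaito2020`) and Cossart–Piltant's property (LU)
(`CPLocalUniformization`) of the local rings `B_𝔭` at maximal ideals of three-dimensional affine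
domains — (LU) being asked there along valuations of EVERY rank. The printed descent of
Cossart–Piltant 2019 (journal Prop. 4.8 = arXiv v1 Prop. 4.6, p. 53) starts with "To begin
with, we may assume that `dim 𝒪_v = 1`, i.e. `Γ_v ⊂ (ℝ, ≥)`, applying [NSp] theorem 1.1", and
its monomialization Lemma 4.7 (= [CoP1] Prop. 8.1) is a rank-one statement. This file makes
the reduction match the print: (LU) for `B_𝔭` is required ONLY along rank-one valuations.

* `exists_fg_regular_of_cpLocalUniformization_centre_rankOne` — the closed-centre step of
  `ArithmeticalThreefoldsClosedPoints.lean` (`exists_fg_regular_of_cpLocalUniformization_centre`)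
  with (LU) for `A_𝔠` assumed along rank-one valuations only and `O` of rank one (proof
  verbatim);
* `localUniformization3_of_closedPoints_rankOne` — surface resolution over every field plus
  (LU) for the `B_𝔭` (`dim B = dim B_𝔭 = 3`) ALONG RANK-ONE VALUATIONS imply
  `LocalUniformization3 k` for every field `k`: Novacoski–Spivakovsky's reduction in
  transcendence degree `≤ 3` (`relLocalUniformization_of_rankOne_of_trdeg_le`,
  `RankOneReductionTrdeg.lean`) followed by the case analysis of
  `localUniformization3_of_closedPoints` at a rank-one valuation.

Universe: the Novacoski–Spivakovsky files are written at `Type`, so the second theorem is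
stated at universe `0` (the universe of the summit statements).

## Sources

* V. Cossart, O. Piltant, *Resolution of singularities of arithmetical threefolds*, J. Algebra
  529 (2019) 268–535 = arXiv:1412.0868, §4.1 (LU) and proof of Prop. 4.8 (arXiv v1: Prop. 4.6,
  pp. 52–53). [CossartPiltant2019]
* J. Novacoski, M. Spivakovsky, *Reduction of local uniformization to the rank one case*
  (2014), Thm. 1.1. [NovacoskiSpivakovsky2014]
-/

noncomputable section

open IsLocalRing Polynomial

open scoped IntermediateField

namespace Literature.AlgebraicGeometry.Resolution

universe u

/-! ## Closed centres of dimension three, (LU) along rank-one valuations -/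

/-- **From (LU) for `A_𝔠` along rank-one valuations back to affine models, at a rank-one `O`.**
Let `A ⊆ O` be an affine model of `K/k` with `O` of rank one and residue field algebraic over
`k`, and assume Cossart–Piltant's (LU) for the local ring `A_𝔠`, `𝔠 = 𝔪_O ∩ A`, along every
RANK-ONE valuation ring containing and dominating it with algebraic residue extension. Then some
finitely generated `A ⊆ A' ⊆ O` is regular at the centre ((LU) gives `T = A_𝔠[s] ⊆ O` regular at
`𝔪_O ∩ T`, and `A' := k[A, s]` satisfies `A' ⊆ T ⊆ A'_{𝔪_O ∩ A'}`). The proof is that of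
`exists_fg_regular_of_cpLocalUniformization_centre` verbatim. [cite: CossartPiltant2019, §4.1 (LU)] -/
theorem exists_fg_regular_of_cpLocalUniformization_centre_rankOne {k K : Type u} [Field k]
    [Field K] [Algebra k K] (O : ValuationSubring K) (A : Subalgebra k K)
    (hAO : A.toSubring ≤ O.toSubring) (hfg : A.FG) (hfr : IsFractionRing A K)
    (halg : ∀ x : O, ∃ p : k[X], p ≠ 0 ∧ O.valuation (aeval (x : K) p) < 1)
    (hrk : Nonempty O.valuation.RankOne)
    (hLU : ∀ (K' : Type u) [Field K'] [Algebra (Localization.AtPrime (centreIdeal A O hAO)) K']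
      [IsFractionRing (Localization.AtPrime (centreIdeal A O hAO)) K'] (O' : ValuationSubring K'),
      Nonempty O'.valuation.RankOne →
      (∀ a : Localization.AtPrime (centreIdeal A O hAO), algebraMap _ K' a ∈ O') →
      (∀ a ∈ maximalIdeal (Localization.AtPrime (centreIdeal A O hAO)),
        O'.valuation (algebraMap _ K' a) < 1) →
      (∀ x : O', ∃ p : (Localization.AtPrime (centreIdeal A O hAO))[X],
        (∃ i, p.coeff i ∉ maximalIdeal (Localization.AtPrime (centreIdeal A O hAO))) ∧
          O'.valuation (p.eval₂ (algebraMap _ K') x) < 1) →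
      ∃ (s : Finset K') (h : (Algebra.adjoin (Localization.AtPrime (centreIdeal A O hAO))
          (s : Set K')).toSubring ≤ O'.toSubring),
        IsRegularLocalRing (Localization.AtPrime
          (Ideal.comap (Subring.inclusion h) (maximalIdeal O')))) :
    ∃ (A' : Subalgebra k K) (h : A'.toSubring ≤ O.toSubring), A ≤ A' ∧ A'.FG ∧
      IsRegularLocalRing (Localization.AtPrime (centreIdeal A' O h)) := by
  classical
  haveI := hfr
  -- `A_𝔠 → K`
  have hunit : ∀ s : (centreIdeal A O hAO).primeCompl, IsUnit (algebraMap A K s) := fun s => by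
    rw [isUnit_iff_ne_zero]
    intro h0
    apply s.2
    have : (s : A) = 0 := (IsFractionRing.injective A K) (h0.trans (map_zero _).symm)
    rw [this]
    exact (centreIdeal A O hAO).zero_mem
  letI : Algebra (Localization.AtPrime (centreIdeal A O hAO)) K :=
    (IsLocalization.lift (M := (centreIdeal A O hAO).primeCompl) hunit).toAlgebra
  haveI : IsScalarTower A (Localization.AtPrime (centreIdeal A O hAO)) K :=
    IsScalarTower.of_algebraMap_eq fun a => (IsLocalization.lift_eq hunit a).symm
  haveI : IsFractionRing (Localization.AtPrime (centreIdeal A O hAO)) K :=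
    IsFractionRing.isFractionRing_of_isDomain_of_isLocalization (centreIdeal A O hAO).primeCompl
      (Localization.AtPrime (centreIdeal A O hAO)) K
  have hAK : ∀ a : A,
      algebraMap (Localization.AtPrime (centreIdeal A O hAO)) K (algebraMap A _ a) = (a : K) :=
    fun a => (IsScalarTower.algebraMap_apply A (Localization.AtPrime (centreIdeal A O hAO)) K a).symm
  -- membership in the centre, values outside the centre
  have hmemc : ∀ a : A, a ∈ centreIdeal A O hAO ↔ O.valuation (a : K) < 1 := fun a => by
    rw [centreIdeal, Ideal.mem_comap, ValuationSubring.valuation_lt_one_iff]; rfl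
  have hval1 : ∀ s : A, s ∉ centreIdeal A O hAO → O.valuation (s : K) = 1 := fun s hs =>
    le_antisymm ((O.valuation_le_one_iff _).mpr (hAO s.2)) (not_lt.mp ((hmemc s).not.mp hs))
  have hmk' : ∀ (a : A) (s : (centreIdeal A O hAO).primeCompl),
      algebraMap _ K (IsLocalization.mk' (Localization.AtPrime (centreIdeal A O hAO)) a s) =
        (a : K) * ((s : A) : K)⁻¹ := by
    intro a s
    have hs1 := hval1 (s : A) s.2
    have hs0 : ((s : A) : K) ≠ 0 := fun h => by
      rw [h, map_zero] at hs1; exact zero_ne_one hs1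
    rw [eq_mul_inv_iff_mul_eq₀ hs0, ← hAK (s : A), ← map_mul, IsLocalization.mk'_spec, hAK]
  -- (1) `A_𝔠 ⊆ O`
  have hLO : ∀ r : Localization.AtPrime (centreIdeal A O hAO), algebraMap _ K r ∈ O := by
    intro r
    obtain ⟨a, s, rfl⟩ := IsLocalization.exists_mk'_eq (centreIdeal A O hAO).primeCompl r
    have hs1 := hval1 (s : A) s.2
    have hsO : ((s : A) : K)⁻¹ ∈ O := by
      rw [← O.valuation_le_one_iff, map_inv₀, hs1, inv_one]
    rw [hmk']
    exact mul_mem (hAO a.2) hsO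
  -- (2) `O` dominates `A_𝔠`
  have hdom : ∀ r ∈ maximalIdeal (Localization.AtPrime (centreIdeal A O hAO)),
      O.valuation (algebraMap _ K r) < 1 := by
    intro r hr
    obtain ⟨a, s, rfl⟩ := IsLocalization.exists_mk'_eq (centreIdeal A O hAO).primeCompl r
    have ha : a ∈ centreIdeal A O hAO :=
      (IsLocalization.AtPrime.mk'_mem_maximal_iff
        (Localization.AtPrime (centreIdeal A O hAO)) (centreIdeal A O hAO) a s).mp hr
    rw [hmk', map_mul, map_inv₀, hval1 (s : A) s.2, inv_one, mul_one]
    exact (hmemc a).mp ha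
  -- (3) residues are algebraic over the residue field of `A_𝔠` (even over `k`)
  have halg' : ∀ x : O, ∃ p : (Localization.AtPrime (centreIdeal A O hAO))[X],
      (∃ i, p.coeff i ∉ maximalIdeal (Localization.AtPrime (centreIdeal A O hAO))) ∧
        O.valuation (p.eval₂ (algebraMap _ K) x) < 1 := by
    intro x
    obtain ⟨q, hq0, hq⟩ := halg x
    refine ⟨q.map (algebraMap k _), ⟨q.natDegree, ?_⟩, ?_⟩
    · rw [Polynomial.coeff_map, Polynomial.coeff_natDegree]
      have hu : IsUnit (algebraMap k (Localization.AtPrime (centreIdeal A O hAO)) q.leadingCoeff) :=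
        (Ne.isUnit (leadingCoeff_ne_zero.mpr hq0)).map _
      exact fun hmem => (mem_nonunits_iff.mp ((IsLocalRing.mem_maximalIdeal _).mp hmem)) hu
    · have hcomp : (algebraMap (Localization.AtPrime (centreIdeal A O hAO)) K).comp
          (algebraMap k _) = algebraMap k K := by
        ext a
        rw [RingHom.comp_apply,
          IsScalarTower.algebraMap_apply k A (Localization.AtPrime (centreIdeal A O hAO)), hAK]
        rfl
      rw [Polynomial.eval₂_map, hcomp, ← Polynomial.aeval_def]
      exact hq
  -- apply (LU) (along the rank-one valuation ring `O`) to `A_𝔠 ⊆ O`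
  obtain ⟨s, hTO, hreg⟩ := hLU K O hrk hLO hdom halg'
  let T : Subalgebra (Localization.AtPrime (centreIdeal A O hAO)) K := Algebra.adjoin _ (s : Set K)
  change T.toSubring ≤ O.toSubring at hTO
  -- the `k`-algebra `A' = k[generators of A, s]`
  obtain ⟨gA, hgA⟩ := hfg
  let A' : Subalgebra k K := Algebra.adjoin k ((gA : Set K) ∪ (s : Set K))
  have hAA' : A ≤ A' := by
    rw [← hgA]; exact Algebra.adjoin_mono Set.subset_union_left
  have hA'fg : A'.FG := ⟨gA ∪ s, by rw [Finset.coe_union]⟩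
  -- `A' ⊆ T`
  have hkT : ∀ a : k, algebraMap k K a ∈ T := fun a => by
    have e : algebraMap k K a =
        algebraMap (Localization.AtPrime (centreIdeal A O hAO)) K (algebraMap k _ a) := by
      rw [IsScalarTower.algebraMap_apply k A (Localization.AtPrime (centreIdeal A O hAO)), hAK]
      rfl
    rw [e]; exact T.algebraMap_mem _
  let Tk : Subalgebra k K := { T.toSubring with algebraMap_mem' := hkT }
  have hA'T : A'.toSubring ≤ T.toSubring := by
    change A' ≤ Tk
    refine Algebra.adjoin_le ?_
    rintro x (hx | hx)
    · have hxA : x ∈ A := by rw [← hgA]; exact Algebra.subset_adjoin hx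
      have hxT := T.algebraMap_mem (algebraMap A (Localization.AtPrime (centreIdeal A O hAO)) ⟨x, hxA⟩)
      rw [hAK] at hxT
      exact hxT
    · change x ∈ T
      exact Algebra.subset_adjoin hx
  have hA'O : A'.toSubring ≤ O.toSubring := hA'T.trans hTO
  refine ⟨A', hA'O, hAA', hA'fg, ?_⟩
  -- every element of `T` is `a'/s'` with `a' ∈ A'`, `s' ∈ A'` a unit of `O`
  have hQ : ∀ x ∈ T.toSubring, ∃ a s' : K, a ∈ A'.toSubring ∧ s' ∈ A'.toSubring ∧
      O.valuation s' = 1 ∧ x * s' = a := by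
    intro x hx
    refine Algebra.adjoin_induction (p := fun x _ => ∃ a s' : K, a ∈ A'.toSubring ∧
      s' ∈ A'.toSubring ∧ O.valuation s' = 1 ∧ x * s' = a) ?_ ?_ ?_ ?_ (show x ∈ T from hx)
    · intro x hx
      exact ⟨x, 1, Algebra.subset_adjoin (Or.inr hx), one_mem _, map_one _, mul_one _⟩
    · intro r
      obtain ⟨a, t, rfl⟩ := IsLocalization.exists_mk'_eq (centreIdeal A O hAO).primeCompl r
      refine ⟨(a : K), ((t : A) : K), hAA' a.2, hAA' (t : A).2, hval1 _ t.2, ?_⟩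
      rw [← hAK (t : A), ← hAK a, ← map_mul, IsLocalization.mk'_spec]
    · rintro x y - - ⟨a₁, s₁, ha₁, hs₁, hv₁, h₁⟩ ⟨a₂, s₂, ha₂, hs₂, hv₂, h₂⟩
      refine ⟨a₁ * s₂ + a₂ * s₁, s₁ * s₂, add_mem (mul_mem ha₁ hs₂) (mul_mem ha₂ hs₁),
        mul_mem hs₁ hs₂, by rw [map_mul, hv₁, hv₂, mul_one], ?_⟩
      rw [← h₁, ← h₂]; ring
    · rintro x y - - ⟨a₁, s₁, ha₁, hs₁, hv₁, h₁⟩ ⟨a₂, s₂, ha₂, hs₂, hv₂, h₂⟩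
      refine ⟨a₁ * a₂, s₁ * s₂, mul_mem ha₁ ha₂, mul_mem hs₁ hs₂,
        by rw [map_mul, hv₁, hv₂, mul_one], ?_⟩
      rw [← h₁, ← h₂]; ring
  haveI : IsFractionRing A'.toSubring K := isFractionRing_of_le hAA' hfr
  haveI : (centreIdeal A' O hA'O).IsPrime := by unfold centreIdeal; infer_instance
  exact isRegularLocalRing_of_sandwich hA'T
    (Ideal.comap (Subring.inclusion hTO) (maximalIdeal O)) (centreIdeal A' O hA'O)
    (Ideal.ext fun _ => Iff.rfl) (sandwich_of_valuation_eq_one O hA'T hTO hQ) hreg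

/-! ## The reduction, at rank one -/

/-- **Local uniformization in dimension `≤ 3` from surface resolution and (LU) at closed centres
of dimension three ALONG RANK-ONE VALUATIONS** (Cossart–Piltant 2019, Ch. 4 with the opening
reduction of the proof of journal Prop. 4.8: "we may assume that `dim 𝒪_v = 1` … applying [NSp]
theorem 1.1"). If weak resolution holds over every field up to dimension `2`
(`CossartJannsenSaito2020`) and Cossart–Piltant's (LU) holds, along every RANK-ONE valuation
ring, for the local ring `B_𝔭` at every maximal ideal `𝔭` of every three-dimensional domain `B`
of finite type over a field with `dim B_𝔭 = 3`, then `LocalUniformization3 k` holds for every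
field `k`. Proof: an affine model of dimension `≤ 3` has a function field of transcendence degree
`≤ 3`, so Novacoski–Spivakovsky's reduction in bounded transcendence degree
(`relLocalUniformization_of_rankOne_of_trdeg_le`) reduces to rank-one valuation rings; there
the case analysis of `localUniformization3_of_closedPoints` applies (dimension `≤ 2`: surface
resolution; a transcendental residue: `exists_fg_regular_of_residue_transcendental`; algebraic
residues: the centre is a closed point of dimension three and
`exists_fg_regular_of_cpLocalUniformization_centre_rankOne`). Universe `0` (the
Novacoski–Spivakovsky files are written at `Type`).
[cite: CossartPiltant2019, §4.1 (LU) and proof of Prop. 4.8 (arXiv v1: Prop. 4.6, pp. 52–53)]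
[cite: NovacoskiSpivakovsky2014, Thm. 1.1] -/
theorem localUniformization3_of_closedPoints_rankOne (hCJS : CossartJannsenSaito2020.{0})
    (h3 : ∀ (k B : Type) [Field k] [CommRing B] [IsDomain B] [Algebra k B]
      [Algebra.FiniteType k B] (p : Ideal B) [p.IsMaximal],
      ringKrullDim B = 3 → ringKrullDim (Localization.AtPrime p) = 3 →
      ∀ (K : Type) [Field K] [Algebra (Localization.AtPrime p) K]
        [IsFractionRing (Localization.AtPrime p) K] (O : ValuationSubring K),
      Nonempty O.valuation.RankOne →
      (∀ a : Localization.AtPrime p, algebraMap _ K a ∈ O) →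
      (∀ a ∈ maximalIdeal (Localization.AtPrime p), O.valuation (algebraMap _ K a) < 1) →
      (∀ x : O, ∃ q : (Localization.AtPrime p)[X],
        (∃ i, q.coeff i ∉ maximalIdeal (Localization.AtPrime p)) ∧
          O.valuation (q.eval₂ (algebraMap _ K) x) < 1) →
      ∃ (s : Finset K) (h : (Algebra.adjoin (Localization.AtPrime p) (s : Set K)).toSubring ≤
          O.toSubring),
        IsRegularLocalRing (Localization.AtPrime
          (Ideal.comap (Subring.inclusion h) (maximalIdeal O))))
    (k : Type) [Field k] : LocalUniformization3 k := by
  classical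
  -- the rank-one case: the case analysis of `localUniformization3_of_closedPoints`
  have hrank1 : ∀ (K : Type) [Field K] [Algebra k K], Algebra.trdeg k K ≤ (3 : ℕ) →
      ∀ O : ValuationSubring K, Nonempty O.valuation.RankOne → RelLocalUniformization k K O := by
    intro K _ _ hK O hrk A hfg hfr hAO
    haveI := hfr
    haveI : Algebra.FiniteType k A := A.fg_iff_finiteType.mp hfg
    have hdim : ringKrullDim A ≤ 3 := ringKrullDim_le_of_fg_of_trdeg_le A hfg hK
    obtain ⟨n, hn, -⟩ := exists_ringKrullDim_eq_and_trdeg_eq k A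
    have hn3 : n ≤ 3 := by
      have h1 : (n : WithBot ℕ∞) ≤ 3 := hn ▸ hdim
      exact_mod_cast h1
    by_cases hn2 : n ≤ 2
    · -- dimension `≤ 2`: surface resolution over `k`
      obtain ⟨A', h', hle, hfg', hreg⟩ :=
        (hCJS k).localUniformization K O A hAO hfg hfr (by rw [hn]; exact_mod_cast hn2)
      exact ⟨A', h', hle, hfg', hreg⟩
    have hA3 : ringKrullDim A = 3 := by
      have h1 : n = 3 := by omega
      rw [hn, h1]; norm_cast
    by_cases hII : ∃ t ∈ O, ∀ p : k[X], p ≠ 0 → O.valuation (aeval t p) = 1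
    · -- a transcendental residue: reduce the dimension over `k(t)`
      obtain ⟨t, htO, ht⟩ := hII
      obtain ⟨A', h', hle, hfg', hreg⟩ :=
        exists_fg_regular_of_residue_transcendental hCJS O A hAO hfg hfr hdim htO ht
      exact ⟨A', h', hle, hfg', hreg⟩
    -- the residue field of `O` is algebraic over `k`: the centre is a closed point of dimension 3
    push Not at hII
    have hkO : ∀ a : k, algebraMap k K a ∈ O := fun a => hAO (A.algebraMap_mem a)
    let Ok : Subalgebra k K := { O.toSubring with algebraMap_mem' := hkO }
    have halg : ∀ x : O, ∃ p : k[X], p ≠ 0 ∧ O.valuation (aeval (x : K) p) < 1 := by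
      intro x
      obtain ⟨p, hp0, hp1⟩ := hII x x.2
      have hmem : aeval (x : K) p ∈ O :=
        (Algebra.adjoin_le (Set.singleton_subset_iff.mpr x.2) : Algebra.adjoin k {(x : K)} ≤ Ok)
          (Polynomial.aeval_mem_adjoin_singleton k (x : K))
      exact ⟨p, hp0, lt_of_le_of_ne ((O.valuation_le_one_iff _).mpr hmem) hp1⟩
    -- the centre `𝔠 = 𝔪_O ∩ A` is a maximal ideal: `A/𝔠` is a domain algebraic over `k`
    haveI hcmax : (centreIdeal A O hAO).IsMaximal := by
      refine Ideal.Quotient.maximal_of_isField _ ?_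
      haveI : Algebra.IsIntegral k (A ⧸ centreIdeal A O hAO) := by
        rw [← Algebra.isAlgebraic_iff_isIntegral]
        refine ⟨fun y => ?_⟩
        obtain ⟨a, rfl⟩ := Ideal.Quotient.mk_surjective y
        obtain ⟨p, hp0, hp⟩ := halg ⟨a, hAO a.2⟩
        refine ⟨p, hp0, ?_⟩
        change aeval (Ideal.Quotient.mkₐ k (centreIdeal A O hAO) a) p = 0
        rw [Polynomial.aeval_algHom_apply]
        change Ideal.Quotient.mk (centreIdeal A O hAO) (aeval a p) = 0
        refine Ideal.Quotient.eq_zero_iff_mem.mpr ?_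
        rw [centreIdeal, Ideal.mem_comap, ValuationSubring.valuation_lt_one_iff]
        change O.valuation ((aeval a p : A) : K) < 1
        rw [Polynomial.aeval_subalgebra_coe]
        exact hp
      exact isField_of_isIntegral_of_isField' (Field.toIsField k)
    have hcdim : ringKrullDim (Localization.AtPrime (centreIdeal A O hAO)) = 3 := by
      rw [ringKrullDim_localization_atPrime_eq_of_isMaximal k (centreIdeal A O hAO), hA3]
    obtain ⟨A', h', hle, hfg', hreg⟩ :=
      exists_fg_regular_of_cpLocalUniformization_centre_rankOne O A hAO hfg hfr halg hrk
        (h3 k A (centreIdeal A O hAO) hA3 hcdim)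
    exact ⟨A', h', hle, hfg', hreg⟩
  -- Novacoski–Spivakovsky in transcendence degree `≤ 3`
  intro K _ _ O A hAO hfg hfr hdim
  haveI := hfr
  haveI : Algebra.FiniteType k A := A.fg_iff_finiteType.mp hfg
  obtain ⟨n, hn, htr⟩ := exists_ringKrullDim_eq_and_trdeg_eq k A
  have hn3 : n ≤ 3 := by
    have h1 : (n : WithBot ℕ∞) ≤ 3 := hn ▸ hdim
    exact_mod_cast h1
  have hK : Algebra.trdeg k K ≤ (3 : ℕ) := by
    rw [trdeg_eq_trdeg_of_isFractionRing A, htr]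
    exact_mod_cast hn3
  obtain ⟨A', h', hle, hfg', hreg⟩ :=
    relLocalUniformization_of_rankOne_of_trdeg_le k 3 hrank1 K hK O A hfg hfr hAO
  exact ⟨A', h', hle, hfg', hreg⟩

end Literature.AlgebraicGeometry.Resolution

end
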